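import Literature.NumberTheory.Transcendental.FormsAlgebraWedgeProofs
import HarnessLib

/-!
# Associativity of the wedge product (named fact `ContinuousAlternatingMap.WedgeAssoc` discharged)

Topic: algebra of differential forms (`Literature/NumberTheory/Transcendental/FormsAlgebra.lean`).
This theorems-only companion file discharges the named fact

| named fact of `FormsAlgebra.lean`              | discharged by                                  |
|------------------------------------------------|------------------------------------------------|
| `ContinuousAlternatingMap.WedgeAssoc 𝕜 V A`    | `ContinuousAlternatingMap.WedgeAssoc_holds`    |

i.e. **associativity** `(α ∧ β) ∧ γ = α ∧ (β ∧ γ)` (up to the reindexing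
`Fin (k + (l + m)) ≃ Fin (k + l + m)`) of the tree's concrete wedge product
`ContinuousAlternatingMap.wedge` of continuous alternating maps on a normed space `V` with values in
a normed commutative `𝕜`-algebra `A` (`𝕜` an `RCLike` field), for all degrees `k l m`. The wedge
carries the shuffle normalisation `(α ∧ β)(v) = (k! l!)⁻¹ ∑_{σ ∈ 𝔖_{k+l}} sgn σ · α(vσ|₁) β(vσ|₂)`
(Warner (1983), 2.10(b), formulas (2)–(4): the product `∧_α` on `A(V)`), which under
`A(V) ≅ Λ(V*)` is the multiplication of the exterior algebra `Λ(V*) = C(V*)/I(V*)`, an associative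
graded algebra (Warner (1983), 2.3–2.4). With `FormsAlgebraWedgeProofs.lean`
(`IsSmoothFormWedge_holds`, `MextDerivWedge_holds`) the hypothesis class `WedgeFacts I M A` of
`FormsAlgebra.lean` now reduces to graded commutativity alone (`wedgeFacts_of_comm`).

## Main statements (all proved)

* `wedge_wedge_apply`: the **triple shuffle formula**, left bracketing:
  `((α ∧ β) ∧ γ)(v) = (k! l! m!)⁻¹ ∑_{σ ∈ 𝔖_{k+l+m}} sgn σ · α(vσ|₁) β(vσ|₂) γ(vσ|₃)`.
* `wedge_wedge_apply'`: the same formula for the right bracketing `α ∧ (β ∧ γ)` on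
  `Fin (k + (l + m))`.
* `ContinuousAlternatingMap.WedgeAssoc_holds`, `wedgeFacts_of_comm`.

## Proof architecture (vs. Warner)

Warner obtains associativity for free: `∧` is the multiplication of the quotient algebra
`C(V)/I(V)` of the (associative) tensor algebra (2.3–2.4), and the shuffle formula 2.10(b)(2) is
then *derived* for the transported product `∧_α` on alternating multilinear functions. Here `∧`
*is* the shuffle formula, so associativity is the combinatorial identity behind 2.10(b): expanding
the inner wedge of `((α ∧ β) ∧ γ)(v)` gives a double sum over `σ ∈ 𝔖_{k+l+m}` and `τ ∈ 𝔖_{k+l}`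
whose summand depends only on the product `σ · (τ ⊕ 1)` with the block permutation `τ ⊕ 1`
(`finSumFinEquiv.permCongr (τ.sumCongr 1)`; `sgn (τ ⊕ 1) = sgn τ`); summing over each coset
collapses the double sum to `(k+l)!` copies of the triple sum (`sum_sum_apply_mul_eq_card_smul`),
and `((k+l)! m!)⁻¹ (k! l!)⁻¹ (k+l)! = (k! l! m!)⁻¹`. Symmetrically for `α ∧ (β ∧ γ)` with the
block permutations `1 ⊕ τ`, `τ ∈ 𝔖_{l+m}`; the two triple sums are identified along
`finCongr : Fin (k + l + m) ≃ Fin (k + (l + m))` (`Equiv.permCongr`, `sign_permCongr`).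

## References

* F. W. Warner, *Foundations of Differentiable Manifolds and Lie Groups*, GTM 94, Springer (1983),
  2.3 (the tensor algebra is associative), 2.4 (exterior algebra `Λ(V) = C(V)/I(V)`, `∧` its
  multiplication), 2.10(b) (the induced products `∧_α`, `∧_β` on `A(V)`; formulas (2)–(4):
  `f ∧_α g = ((p+q)!/(p! q!)) f ∧_β g = (p! q!)⁻¹ ∑_{π ∈ 𝔖_{p+q}} sgn π · f g`).
* Mathlib: `Mathlib/GroupTheory/Perm/Sign.lean` (`Equiv.Perm.sign_sumCongr`,
  `Equiv.Perm.sign_permCongr`), `Mathlib/Logic/Equiv/Fin/Basic.lean` (`finSumFinEquiv`).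

Not here: graded commutativity (`ContinuousAlternatingMap.WedgeComm`, still a named fact) and the
comparison with `AlternatingMap.domCoprod` (`ContinuousAlternatingMap.ToAlternatingMapWedge`).
-/

noncomputable section

open Function

namespace Literature.NumberTheory.Transcendental

/-! ### Block permutations of `Fin (p + q)` -/

section BlockPerm

variable {p q : ℕ}

/-- The block permutation `τ ⊕ 1` of `Fin (p + q)` (along `finSumFinEquiv`) acts as `τ` on the
first block: `(τ ⊕ 1) (castAdd q i) = castAdd q (τ i)`. [folklore] -/
theorem permCongr_sumCongr_one_apply_castAdd (τ : Equiv.Perm (Fin p)) (i : Fin p) :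
    finSumFinEquiv.permCongr (τ.sumCongr (1 : Equiv.Perm (Fin q))) (Fin.castAdd q i) =
      Fin.castAdd q (τ i) := by
  simp [Equiv.permCongr_apply]

/-- The block permutation `τ ⊕ 1` of `Fin (p + q)` fixes the second block:
`(τ ⊕ 1) (natAdd p j) = natAdd p j`. [folklore] -/
theorem permCongr_sumCongr_one_apply_natAdd (τ : Equiv.Perm (Fin p)) (j : Fin q) :
    finSumFinEquiv.permCongr (τ.sumCongr (1 : Equiv.Perm (Fin q))) (Fin.natAdd p j) =
      Fin.natAdd p j := by
  simp [Equiv.permCongr_apply]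

/-- The block permutation `1 ⊕ τ` of `Fin (p + q)` fixes the first block:
`(1 ⊕ τ) (castAdd q i) = castAdd q i`. [folklore] -/
theorem permCongr_one_sumCongr_apply_castAdd (τ : Equiv.Perm (Fin q)) (i : Fin p) :
    finSumFinEquiv.permCongr ((1 : Equiv.Perm (Fin p)).sumCongr τ) (Fin.castAdd q i) =
      Fin.castAdd q i := by
  simp [Equiv.permCongr_apply]

/-- The block permutation `1 ⊕ τ` of `Fin (p + q)` acts as `τ` on the second block:
`(1 ⊕ τ) (natAdd p j) = natAdd p (τ j)`. [folklore] -/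
theorem permCongr_one_sumCongr_apply_natAdd (τ : Equiv.Perm (Fin q)) (j : Fin q) :
    finSumFinEquiv.permCongr ((1 : Equiv.Perm (Fin p)).sumCongr τ) (Fin.natAdd p j) =
      Fin.natAdd p (τ j) := by
  simp [Equiv.permCongr_apply]

/-- The sign of a block permutation `τ₁ ⊕ τ₂` of `Fin (p + q)` is `sgn τ₁ · sgn τ₂`
(`Equiv.Perm.sign_sumCongr` transported along `finSumFinEquiv`). [folklore] -/
theorem sign_permCongr_sumCongr (τ₁ : Equiv.Perm (Fin p)) (τ₂ : Equiv.Perm (Fin q)) :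
    Equiv.Perm.sign (finSumFinEquiv.permCongr (τ₁.sumCongr τ₂)) =
      Equiv.Perm.sign τ₁ * Equiv.Perm.sign τ₂ := by
  rw [Equiv.Perm.sign_permCongr, Equiv.Perm.sign_sumCongr]

/-- Summing `F (σ * h i)` over all elements `σ` of a finite group and all `i : ι` gives `#ι`
copies of `∑ σ, F σ` (each right translation is a bijection of the group). [folklore] -/
theorem sum_sum_apply_mul_eq_card_smul {G : Type*} [Group G] [Fintype G] {ι : Type*} [Fintype ι]
    {β : Type*} [AddCommMonoid β] (h : ι → G) (F : G → β) :
    ∑ i, ∑ σ, F (σ * h i) = Fintype.card ι • ∑ σ, F σ := by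
  have hi : ∀ i, ∑ σ, F (σ * h i) = ∑ σ, F σ := fun i ↦
    Fintype.sum_equiv (Equiv.mulRight (h i)) _ _ fun _ ↦ rfl
  simp only [hi, Finset.sum_const, Finset.card_univ]

end BlockPerm

/-! ### The iterated wedge as a single alternating sum -/

section Assoc

variable {𝕜 : Type*} [RCLike 𝕜] {V : Type*} [NormedAddCommGroup V] [NormedSpace 𝕜 V]
  {A : Type*} [NormedCommRing A] [NormedAlgebra 𝕜 A] {k l m : ℕ}

/-- **Triple shuffle formula, left bracketing.** For continuous alternating maps `α`, `β`, `γ` of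
degrees `k`, `l`, `m`,
`((α ∧ β) ∧ γ)(v) = (k! l! m!)⁻¹ ∑_{σ ∈ 𝔖_{k+l+m}} sgn σ · α(v_{σ(0)}, …) β(v_{σ(k)}, …) γ(v_{σ(k+l)}, …)`.
This is Warner's formula 2.10(b)(2)/(4) for a triple product: expanding the inner wedge, the
summand indexed by `(σ, τ) ∈ 𝔖_{k+l+m} × 𝔖_{k+l}` depends only on `σ · (τ ⊕ 1)`, and each coset
sum contributes the full triple sum, `(k+l)!` times in all; finally
`((k+l)! m!)⁻¹ (k! l!)⁻¹ (k+l)! = (k! l! m!)⁻¹`. [folklore] -/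
theorem wedge_wedge_apply (α : V [⋀^Fin k]→L[𝕜] A) (β : V [⋀^Fin l]→L[𝕜] A)
    (γ : V [⋀^Fin m]→L[𝕜] A) (v : Fin (k + l + m) → V) :
    (α.wedge β).wedge γ v = ((k.factorial * l.factorial * m.factorial : ℕ) : 𝕜)⁻¹ •
      ∑ σ : Equiv.Perm (Fin (k + l + m)), (Equiv.Perm.sign σ : ℤ) •
        (α (fun i ↦ v (σ (Fin.castAdd m (Fin.castAdd l i)))) *
          β (fun i ↦ v (σ (Fin.castAdd m (Fin.natAdd k i)))) *
          γ (fun i ↦ v (σ (Fin.natAdd (k + l) i)))) := by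
  -- the summand of the right-hand side
  set G : Equiv.Perm (Fin (k + l + m)) → A := fun σ ↦ (Equiv.Perm.sign σ : ℤ) •
      (α (fun i ↦ v (σ (Fin.castAdd m (Fin.castAdd l i)))) *
        β (fun i ↦ v (σ (Fin.castAdd m (Fin.natAdd k i)))) *
        γ (fun i ↦ v (σ (Fin.natAdd (k + l) i)))) with hG
  -- the block embedding `𝔖_{k+l} → 𝔖_{k+l+m}`, `τ ↦ τ ⊕ 1`
  set ι : Equiv.Perm (Fin (k + l)) → Equiv.Perm (Fin (k + l + m)) := fun τ ↦
    finSumFinEquiv.permCongr (τ.sumCongr 1) with hι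
  -- each outer summand is an inner sum of values of `G` on a coset of `𝔖_{k+l}`
  have hterm : ∀ σ : Equiv.Perm (Fin (k + l + m)),
      (Equiv.Perm.sign σ : ℤ) • ((α.wedge β) (fun i ↦ v (σ (Fin.castAdd m i))) *
        γ (fun j ↦ v (σ (Fin.natAdd (k + l) j)))) =
      ((k.factorial * l.factorial : ℕ) : 𝕜)⁻¹ •
        ∑ τ : Equiv.Perm (Fin (k + l)), G (σ * ι τ) := by
    intro σ
    rw [wedge_apply_zsmul, smul_mul_assoc, smul_comm, Finset.sum_mul, Finset.smul_sum]
    refine congrArg _ (Finset.sum_congr rfl fun τ _ ↦ ?_)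
    simp only [hG, hι, Equiv.Perm.coe_mul, Function.comp_apply,
      permCongr_sumCongr_one_apply_castAdd, permCongr_sumCongr_one_apply_natAdd,
      Equiv.Perm.sign_mul, sign_permCongr_sumCongr, Equiv.Perm.sign_one, mul_one,
      Units.val_mul, mul_smul, smul_mul_assoc]
  rw [wedge_apply_zsmul, Finset.sum_congr rfl fun σ _ ↦ hterm σ, ← Finset.smul_sum, smul_smul,
    Finset.sum_comm, sum_sum_apply_mul_eq_card_smul ι G, Fintype.card_perm, Fintype.card_fin,
    ← Nat.cast_smul_eq_nsmul 𝕜, smul_smul]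
  congr 1
  have h1 : ((k + l).factorial : 𝕜) ≠ 0 := Nat.cast_ne_zero.2 (Nat.factorial_ne_zero _)
  have h2 : (k.factorial : 𝕜) ≠ 0 := Nat.cast_ne_zero.2 (Nat.factorial_ne_zero _)
  have h3 : (l.factorial : 𝕜) ≠ 0 := Nat.cast_ne_zero.2 (Nat.factorial_ne_zero _)
  have h4 : (m.factorial : 𝕜) ≠ 0 := Nat.cast_ne_zero.2 (Nat.factorial_ne_zero _)
  push_cast
  field_simp

/-- **Triple shuffle formula, right bracketing.** For continuous alternating maps `α`, `β`, `γ` of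
degrees `k`, `l`, `m` and `w : Fin (k + (l + m)) → V`,
`(α ∧ (β ∧ γ))(w) = (k! l! m!)⁻¹ ∑_{σ ∈ 𝔖_{k+(l+m)}} sgn σ · α(w_{σ(0)}, …) β(w_{σ(k)}, …) γ(w_{σ(k+l)}, …)`
(Warner (1983), 2.10(b)(2)/(4) for a triple product; same coset argument as `wedge_wedge_apply`,
with the block permutations `1 ⊕ τ`, `τ ∈ 𝔖_{l+m}`). [folklore] -/
theorem wedge_wedge_apply' (α : V [⋀^Fin k]→L[𝕜] A) (β : V [⋀^Fin l]→L[𝕜] A)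
    (γ : V [⋀^Fin m]→L[𝕜] A) (w : Fin (k + (l + m)) → V) :
    α.wedge (β.wedge γ) w = ((k.factorial * l.factorial * m.factorial : ℕ) : 𝕜)⁻¹ •
      ∑ σ : Equiv.Perm (Fin (k + (l + m))), (Equiv.Perm.sign σ : ℤ) •
        (α (fun i ↦ w (σ (Fin.castAdd (l + m) i))) *
          (β (fun i ↦ w (σ (Fin.natAdd k (Fin.castAdd m i)))) *
            γ (fun i ↦ w (σ (Fin.natAdd k (Fin.natAdd l i)))))) := by
  -- the summand of the right-hand side
  set G : Equiv.Perm (Fin (k + (l + m))) → A := fun σ ↦ (Equiv.Perm.sign σ : ℤ) •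
      (α (fun i ↦ w (σ (Fin.castAdd (l + m) i))) *
        (β (fun i ↦ w (σ (Fin.natAdd k (Fin.castAdd m i)))) *
          γ (fun i ↦ w (σ (Fin.natAdd k (Fin.natAdd l i)))))) with hG
  -- the block embedding `𝔖_{l+m} → 𝔖_{k+(l+m)}`, `τ ↦ 1 ⊕ τ`
  set ι : Equiv.Perm (Fin (l + m)) → Equiv.Perm (Fin (k + (l + m))) := fun τ ↦
    finSumFinEquiv.permCongr (Equiv.Perm.sumCongr (1 : Equiv.Perm (Fin k)) τ) with hι
  -- each outer summand is an inner sum of values of `G` on a coset of `𝔖_{l+m}`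
  have hterm : ∀ σ : Equiv.Perm (Fin (k + (l + m))),
      (Equiv.Perm.sign σ : ℤ) • (α (fun i ↦ w (σ (Fin.castAdd (l + m) i))) *
        (β.wedge γ) (fun j ↦ w (σ (Fin.natAdd k j)))) =
      ((l.factorial * m.factorial : ℕ) : 𝕜)⁻¹ •
        ∑ τ : Equiv.Perm (Fin (l + m)), G (σ * ι τ) := by
    intro σ
    rw [wedge_apply_zsmul, mul_smul_comm, smul_comm, Finset.mul_sum, Finset.smul_sum]
    refine congrArg _ (Finset.sum_congr rfl fun τ _ ↦ ?_)
    simp only [hG, hι, Equiv.Perm.coe_mul, Function.comp_apply,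
      permCongr_one_sumCongr_apply_castAdd, permCongr_one_sumCongr_apply_natAdd,
      Equiv.Perm.sign_mul, sign_permCongr_sumCongr, Equiv.Perm.sign_one, one_mul,
      Units.val_mul, mul_smul, mul_smul_comm]
  rw [wedge_apply_zsmul, Finset.sum_congr rfl fun σ _ ↦ hterm σ, ← Finset.smul_sum, smul_smul,
    Finset.sum_comm, sum_sum_apply_mul_eq_card_smul ι G, Fintype.card_perm, Fintype.card_fin,
    ← Nat.cast_smul_eq_nsmul 𝕜, smul_smul]
  congr 1
  have h1 : ((l + m).factorial : 𝕜) ≠ 0 := Nat.cast_ne_zero.2 (Nat.factorial_ne_zero _)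
  have h2 : (k.factorial : 𝕜) ≠ 0 := Nat.cast_ne_zero.2 (Nat.factorial_ne_zero _)
  have h3 : (l.factorial : 𝕜) ≠ 0 := Nat.cast_ne_zero.2 (Nat.factorial_ne_zero _)
  have h4 : (m.factorial : 𝕜) ≠ 0 := Nat.cast_ne_zero.2 (Nat.factorial_ne_zero _)
  push_cast
  field_simp

variable (𝕜 V A) in
/-- Discharge of the named fact `ContinuousAlternatingMap.WedgeAssoc`: **associativity of the wedge
product** of continuous alternating maps on a normed space with values in a normed commutative
algebra, `(α ∧ β) ∧ γ = α ∧ (β ∧ γ)` up to the reindexing `Fin (k + (l + m)) ≃ Fin (k + l + m)`,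
for all degrees `k l m`. Warner (1983): `∧` is the multiplication of the exterior algebra
`Λ(V) = C(V)/I(V)`, an associative graded algebra (2.3–2.4), and under `A(V) ≅ Λ(V*)` this
multiplication is the shuffle product
`f ∧_α g = (p! q!)⁻¹ ∑_{π ∈ 𝔖_{p+q}} sgn π · f(v_{π(1)}, …) g(v_{π(p+1)}, …)` (2.10(b), (2)–(4)),
the normalisation of `ContinuousAlternatingMap.wedge`. Proof here: both bracketings equal the
triple shuffle sum `(k! l! m!)⁻¹ ∑_σ sgn σ · α β γ` (`wedge_wedge_apply`, `wedge_wedge_apply'`),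
identified along `finCongr (Nat.add_assoc k l m)` (`Equiv.permCongr`). Deliberate declaration
into the Mathlib namespace `ContinuousAlternatingMap`: the `_holds` companion (D-0014) of the
named fact declared there by `FormsAlgebra.lean`. [cite: WarnerGTM94, 2.4 / 2.10(b)] -/
theorem _root_.ContinuousAlternatingMap.WedgeAssoc_holds :
    ContinuousAlternatingMap.WedgeAssoc 𝕜 V A := by
  intro k l m α β γ
  ext v
  rw [ContinuousAlternatingMap.domDomCongr_apply, wedge_wedge_apply, wedge_wedge_apply']
  congr 1
  -- transport the triple sum along `Fin (k + l + m) ≃ Fin (k + (l + m))`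
  refine Fintype.sum_equiv (finCongr (Nat.add_assoc k l m)).permCongr _ _ fun σ ↦ ?_
  have e1 : ∀ i : Fin k,
      Fin.cast (Nat.add_assoc k l m).symm (Fin.castAdd (l + m) i) =
        Fin.castAdd m (Fin.castAdd l i) :=
    fun i ↦ rfl
  have e2 : ∀ i : Fin l,
      Fin.cast (Nat.add_assoc k l m).symm (Fin.natAdd k (Fin.castAdd m i)) =
        Fin.castAdd m (Fin.natAdd k i) :=
    fun i ↦ rfl
  have e3 : ∀ i : Fin m,
      Fin.cast (Nat.add_assoc k l m).symm (Fin.natAdd k (Fin.natAdd l i)) =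
        Fin.natAdd (k + l) i :=
    fun i ↦ Fin.ext (Nat.add_assoc k l i).symm
  simp only [Equiv.Perm.sign_permCongr, Equiv.permCongr_apply, finCongr_symm, finCongr_apply,
    Function.comp_apply, Fin.cast_cast, Fin.cast_eq_self, e1, e2, e3, mul_assoc]

end Assoc

/-! ### The hypothesis class `WedgeFacts` reduces to graded commutativity -/

section WedgeFacts

variable {E : Type*} [NormedAddCommGroup E] [NormedSpace ℝ E]
  {H : Type*} [TopologicalSpace H] {I : ModelWithCorners ℝ E H}
  {M : Type*} [TopologicalSpace M] [ChartedSpace H M]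
  {A : Type*} [NormedCommRing A] [NormedAlgebra ℝ A]

/-- With `IsSmoothFormWedge_holds`, `MextDerivWedge_holds` (`FormsAlgebraWedgeProofs.lean`) and
`ContinuousAlternatingMap.WedgeAssoc_holds`, the hypothesis class `WedgeFacts I M A` of
`FormsAlgebra.lean` reduces to the single remaining named fact, graded commutativity of `∧` on the
model space (`ContinuousAlternatingMap.WedgeComm`). [folklore] -/
theorem wedgeFacts_of_comm (hcomm : ContinuousAlternatingMap.WedgeComm ℝ E A) : WedgeFacts I M A :=
  wedgeFacts_of_assoc_comm (ContinuousAlternatingMap.WedgeAssoc_holds ℝ E A) hcomm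

end WedgeFacts

end Literature.NumberTheory.Transcendental
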